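import Literature.AnabelianGeometry.AbsoluteAnabelian.AbsTopIProp410TemperedModelCofreeCore
import Literature.AnabelianGeometry.SemiGraphs.TemperedFibreProductCompletion
import HarnessLib

/-!
# [AbsTopI] Prop 4.10 (iii): rank-three free-group bookkeeping and topological finite generation of
# the fibre product `P ×_Z ℤ` from a finite generating set (proof-only)

S. Mochizuki, *Topics in Absolute Anabelian Geometry I: Generalities* [AbsTopI] (2012), §0 p. 8
("topologically finitely generated"), Def 4.2 (iii)(c) p. 50, Prop 4.10 (iii) p. 60; manuscript
pagination, lit key `paper:url-11ac98ba15fc`.  S. Mochizuki, *Semi-graphs of anabelioids* [SemiAnbd]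
Prop 3.6 (iii) p. 38 / Ex 3.10 pp. 43–45 (fibre-product tempered models of abc-iut-w5-d218,
`TemperedFibreProduct*.lean`: FIBREWISE DENSITY `exists_inv_mul_eta_mem_and_apply_eq`).

Ingredients of the non-compact tempered model of `AbsTopIProp410TemperedModelSchemaNegative.lean`
(node AbsTopI:Prop4.10(iii) of `HOME/plan/L4/SUBDAG-AbsTopI-Prop410.md`):
* `TemperedFibreProduct.topologicalClosure_closure_graph_eq_top` — for `Γ = P ×_Z ℤ` and a finite
  generating set `T` of `F`, the graph elements `(η t, s t)`, `t ∈ T`, generate a DENSE subgroup of `Γ`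
  (density of the graph of `F`, from fibrewise density and the slice basis; cf. the [EtTh]-model twin
  `SettingModelGfpTopologicallyFinitelyGenerated.lean`, not imported here to keep this file on built
  modules);
* the projection `π : F₃ → F₂`, `a ↦ 1`, `b ↦ x`, `c ↦ y`, its section `s : x ↦ b, y ↦ c`, and the
  exponent sums: `proj₃_section` (`π ∘ s = id`), `ker_proj₃_le_normalClosure` (`Ker π ≤ ⟨⟨a⟩⟩`: the
  quotient map `F₃ → F₃/⟨⟨a⟩⟩` factors through `s ∘ π`, `FreeGroup.ext_hom`), `expSum₂_comp_proj₃`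
  (the `y`-exponent of `π u` is the `c`-exponent of `u`).
PROOF-ONLY (no `def`, no instance, no named fact; FACT-LIST untouched).  HONEST FRAMING: classical;
refereed prerequisite papers; nothing here bears on [IUTchIII] Cor 3.12; typed ≠ proved.
-/

noncomputable section

open _root_.Topology _root_.Filter _root_.Set _root_.Function

/-! ### Density of the graph of `F` in `Γ = P ×_Z ℤ`, generator form -/

namespace Literature.AnabelianGeometry.SemiGraphs.TemperedFibreProduct

universe u v w

variable {P : Type u} [Group P] [TopologicalSpace P] [IsTopologicalGroup P] [CompactSpace P]
  [TotallyDisconnectedSpace P]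
variable {Z : Type v} [Group Z] [TopologicalSpace Z]
variable (e : P →ₜ* Z) (ι : Multiplicative ℤ →* Z)
variable (Γ : Subgroup (P × Multiplicative ℤ)) (hΓ : ∀ p, p ∈ Γ ↔ e p.1 = ι p.2)
variable {F : Type w} [Group F] (η : F →* P) (hηd : DenseRange η)
  (s : F →* Multiplicative ℤ) (hs : Surjective s) (hes : ∀ g, e (η g) = ι (s g))
  (hZ : ∀ A : Subgroup (Multiplicative ℤ), A.FiniteIndex →
    ∀ k : Multiplicative ℤ, ι k ∈ closure (ι '' (A : Set (Multiplicative ℤ))) → k ∈ A)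

include hΓ hηd hs hes hZ in
/-- The graph map `F → Γ`, `g ↦ (η g, s g)`, has dense range (fibrewise density + the slices
`(V × 0) ∩ Γ` form a basis of neighbourhoods of `1`); a private twin of the [EtTh]-model lemma.
[cite: MochizukiSemiAnbd2006, Prop 3.6(iii) p.38] -/
private theorem denseRange_graph_aux (gr : F →* Γ)
    (hgr : ∀ g, ((gr g : Γ) : P × Multiplicative ℤ) = (η g, s g)) : DenseRange gr := by
  classical
  intro q
  rw [mem_closure_iff_nhds]
  intro U hU
  have hU1 : (fun r : Γ => q * r) ⁻¹' U ∈ 𝓝 (1 : Γ) := by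
    have hc : Continuous (fun r : Γ => q * r) := continuous_const.mul continuous_id
    exact hc.continuousAt.preimage_mem_nhds (by simpa using hU)
  obtain ⟨V, N, -, hN, hNU⟩ := exists_openNormal_le_of_mem_nhds Γ hU1
  obtain ⟨⟨x, n⟩, hq⟩ := q
  have hx : e x = ι n := (hΓ _).mp hq
  obtain ⟨g, hg, hsg⟩ := exists_inv_mul_eta_mem_and_apply_eq e ι η hηd s hs hes hZ V x n hx
  refine ⟨gr g, ?_, ⟨g, rfl⟩⟩
  have hmem : (⟨(x, n), hq⟩ : Γ)⁻¹ * gr g ∈ N := by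
    rw [hN]
    refine ⟨?_, ?_⟩
    · change x⁻¹ * ((gr g : Γ) : P × Multiplicative ℤ).1 ∈ V
      rw [hgr]; exact hg
    · change n⁻¹ * ((gr g : Γ) : P × Multiplicative ℤ).2 = 1
      rw [hgr]; change n⁻¹ * s g = 1; rw [hsg, inv_mul_cancel]
  have := hNU hmem
  simpa using this

include hΓ hηd hs hes hZ in
/-- **`Γ = P ×_Z ℤ` is topologically generated by the graph elements `(η t, s t)` of a finite
generating set `T` of `F`** (the generated subgroup is the image of `F`, dense by fibrewise density).
[cite: MochizukiAbsTopI2012, §0 p.8] -/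
theorem topologicalClosure_closure_graph_eq_top (gr : F →* Γ)
    (hgr : ∀ g, ((gr g : Γ) : P × Multiplicative ℤ) = (η g, s g)) (T : Finset F)
    (hT : Subgroup.closure (T : Set F) = ⊤) [DecidableEq Γ] :
    (Subgroup.closure ((T.image gr : Finset Γ) : Set Γ)).topologicalClosure = ⊤ := by
  rw [Finset.coe_image, ← MonoidHom.map_closure, hT, ← MonoidHom.range_eq_map]
  apply SetLike.coe_injective
  rw [Subgroup.topologicalClosure_coe, Subgroup.coe_top, MonoidHom.coe_range]
  exact (denseRange_graph_aux e ι Γ hΓ η hηd s hs hes hZ gr hgr).closure_range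

end Literature.AnabelianGeometry.SemiGraphs.TemperedFibreProduct

/-! ### The projection `F₃ → F₂` killing the first generator -/

namespace Literature.AnabelianGeometry.AbsoluteAnabelian.AbsTopI.Prop410

/-- `π ∘ s = id` for `π : a ↦ 1, b ↦ x, c ↦ y` and its section `s : x ↦ b, y ↦ c`.
[cite: MochizukiAbsTopI2012, Def 4.2 (iii) p.50] -/
theorem proj₃_section (w : FreeGroup (Fin 2)) :
    FreeGroup.lift ![(1 : FreeGroup (Fin 2)), FreeGroup.of 0, FreeGroup.of 1]
      (FreeGroup.lift ![FreeGroup.of (1 : Fin 3), FreeGroup.of 2] w) = w := by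
  have h : (FreeGroup.lift ![(1 : FreeGroup (Fin 2)), FreeGroup.of 0, FreeGroup.of 1]).comp
      (FreeGroup.lift ![FreeGroup.of (1 : Fin 3), FreeGroup.of 2]) = MonoidHom.id _ :=
    FreeGroup.ext_hom _ _ fun i => match i with
      | 0 => by simp
      | 1 => by simp
  exact DFunLike.congr_fun h w

/-- `Ker π ≤ ⟨⟨a⟩⟩`: the quotient map `F₃ → F₃/⟨⟨a⟩⟩` factors through `s ∘ π` (`FreeGroup.ext_hom`), so
`u = (s π u)⁻¹ · u` modulo `⟨⟨a⟩⟩` lies in `⟨⟨a⟩⟩` whenever `π u = 1`.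
[cite: MochizukiAbsTopI2012, Def 4.2 (iii) p.50] -/
theorem ker_proj₃_le_normalClosure :
    (FreeGroup.lift ![(1 : FreeGroup (Fin 2)), FreeGroup.of 0, FreeGroup.of 1]).ker ≤
      Subgroup.normalClosure ({FreeGroup.of 0} : Set (FreeGroup (Fin 3))) := by
  intro u hu
  let π : FreeGroup (Fin 3) →* FreeGroup (Fin 2) :=
    FreeGroup.lift ![(1 : FreeGroup (Fin 2)), FreeGroup.of 0, FreeGroup.of 1]
  let s : FreeGroup (Fin 2) →* FreeGroup (Fin 3) := FreeGroup.lift ![FreeGroup.of (1 : Fin 3), FreeGroup.of 2]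
  let Ncl : Subgroup (FreeGroup (Fin 3)) := Subgroup.normalClosure ({FreeGroup.of 0} : Set _)
  have hqa : (QuotientGroup.mk' Ncl) (FreeGroup.of 0) = 1 :=
    (QuotientGroup.eq_one_iff _).mpr (Subgroup.subset_normalClosure (Set.mem_singleton _))
  have hhom : QuotientGroup.mk' Ncl = (QuotientGroup.mk' Ncl).comp (s.comp π) := by
    refine FreeGroup.ext_hom _ _ fun i => ?_
    match i with
    | 0 =>
      rw [hqa, MonoidHom.comp_apply, MonoidHom.comp_apply]
      simp [π]
    | 1 => rw [MonoidHom.comp_apply, MonoidHom.comp_apply]; simp [π, s]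
    | 2 => rw [MonoidHom.comp_apply, MonoidHom.comp_apply]; simp [π, s]
  have hπu : π u = 1 := (MonoidHom.mem_ker).mp hu
  have hq : (QuotientGroup.mk' Ncl) u = 1 := by
    rw [hhom, MonoidHom.comp_apply, MonoidHom.comp_apply, hπu, map_one, map_one]
  exact (QuotientGroup.eq_one_iff u).mp hq

/-- The `y`-exponent (second generator of `F₂`) of `π u` is the `c`-exponent (third generator of `F₃`)
of `u`. [cite: MochizukiAbsTopI2012, Def 4.2 (iii) p.50] -/
theorem expSum₂_comp_proj₃ (u : FreeGroup (Fin 3)) :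
    (FreeGroup.lift fun j : Fin 2 => if j = 1 then Multiplicative.ofAdd (1 : ℤ) else 1)
      (FreeGroup.lift ![(1 : FreeGroup (Fin 2)), FreeGroup.of 0, FreeGroup.of 1] u) =
    (FreeGroup.lift fun j : Fin 3 => if j = 2 then Multiplicative.ofAdd (1 : ℤ) else 1) u := by
  have h : (FreeGroup.lift fun j : Fin 2 => if j = 1 then Multiplicative.ofAdd (1 : ℤ) else 1).comp
      (FreeGroup.lift ![(1 : FreeGroup (Fin 2)), FreeGroup.of 0, FreeGroup.of 1]) =
      (FreeGroup.lift fun j : Fin 3 => if j = 2 then Multiplicative.ofAdd (1 : ℤ) else 1) :=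
    FreeGroup.ext_hom _ _ fun i => match i with
      | 0 => by simp
      | 1 => by simp
      | 2 => by simp
  exact DFunLike.congr_fun h u

end Literature.AnabelianGeometry.AbsoluteAnabelian.AbsTopI.Prop410

end
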